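import Summits.CriticalPhenomena.PercolationContinuityZ3.Theorems.PercNearOneGluingNoHeavyLowerTailSunflowerBlowupPentagon
import HarnessLib

/-!
# `NoHeavyLowerTail` (crux stmt-CriticalPhenomena-4575), abstract sunflower cubic: the ANDRÁSFAI GRAPHS — typed conjecture (And)

Support file (seat `prim-ineq-prove-1` gen 42; `--supports stmt-CriticalPhenomena-4575`; `--computational` only through the pentagon
certificate behind `safe_andrasfai_one`).  No `sorry`, no named facts.  Memo: run/shared/lean/prim/prim-ineq-prove-1/FINDING-BLOWUP-prove1-g42.md §3, §5.

By `…SunflowerBlowup` / `…SunflowerBlowupSaturated` the typed conjecture `TriangleFreeSafe` (g39) is equivalent to its restriction to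
TWIN-FREE MAXIMAL triangle-free graphs ("primes").  The exact generation of all triangle-free graphs on `≤ 10` vertices (memo §2c)
finds as primes `K₂` (2 vertices), `C₅` (5), the Möbius ladder `M₈` (8), one graph on 9 and two on 10 vertices; the first three are
the ANDRÁSFAI GRAPHS `And_1, And_2, And_3`: `And_k = Cayley(ℤ_{3k−1}, {d ≡ 1 mod 3})`, triangle-free, vertex-transitive, every
maximal independent set a neighbourhood (Pach), the extremal graphs of the dense triangle-free structure theory (Andrásfai–Erdős–Sós,
Häggkvist, Jin, Brandt).  Here (indexing so that `andrasfai k` has `3k + 2` vertices, i.e. `andrasfai k = And_{k+1}`):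
* `andrasfai k : SimpleGraph (Fin (3k+2))` — `u ~ v` iff the difference of the labels is `≡ 1 (mod 3)` read in `ℤ_{3k+2}`
  (as `3k+2 ≡ 2`, this is symmetric); `cliqueFree_three_andrasfai`; `andrasfai_zero_eq_top` (`K₂`), `andrasfai_one_eq_cycleGraph` (`C₅`).
* **`AndrasfaiSafe`** (typed conjecture (And)): every Andrásfai graph has an A-safe graph core.  `andrasfaiSafe_of_triangleFreeSafe`
  (it is a sub-conjecture of G△); discharged instances `safe_andrasfai_zero` (`K₂`: principal core) and `safe_andrasfai_one` (`C₅`,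
  the pentagon certificate); `safe_andrasfai_comap_of_andrasfaiSafe` (with the blow-up theorem it would give every blow-up, i.e. by
  Pach's theorem every triangle-free graph in which each independent set has a common neighbour, and every maximal triangle-free
  3-colourable graph of minimum degree `> n/3`).  Evidence (memo §2c, §5): `And_3 = M₈` exact polarised census, `And_4, And_5`
  Lemma A(3) over all 3-block partitions × adversarial `p`, `And_k, k ≤ 6` hill-climbing `K ≤ 6`: no violation.
-/

noncomputable section

namespace Summit.CriticalPhenomena.PercolationContinuityZ3.Theorems.SunflowerPartition

namespace SafeCalc

open Finset

variable {ι : Type*} [Fintype ι]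

/-- The Andrásfai graph `And_{k+1}` on `Fin (3k+2)`: labels whose cyclic difference is `≡ 1 (mod 3)` are adjacent (for `u < v`:
`v − u ≡ 1`, equivalently `u − v + (3k+2) ≡ 1 (mod 3)`). [this work] -/
def andrasfai (k : ℕ) : SimpleGraph (Fin (3 * k + 2)) where
  Adj u v := (u.val < v.val ∧ (v.val - u.val) % 3 = 1) ∨ (v.val < u.val ∧ (u.val - v.val) % 3 = 1)
  symm := ⟨fun _ _ h => h.symm⟩
  loopless := ⟨fun _ h => by rcases h with ⟨h, -⟩ | ⟨h, -⟩ <;> exact lt_irrefl _ h⟩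

/-- Adjacency in `andrasfai k` is decidable (used for the `decide` proofs below). [this work] -/
instance andrasfai.decidableRel (k : ℕ) : DecidableRel (andrasfai k).Adj := fun u v => by
  unfold andrasfai; infer_instance

/-- The Andrásfai graphs are triangle-free (two steps `≡ 1 (mod 3)` make a step `≡ 2`). [this work] -/
theorem cliqueFree_three_andrasfai (k : ℕ) : (andrasfai k).CliqueFree 3 := by
  classical
  intro t ht
  rw [SimpleGraph.is3Clique_iff] at ht
  obtain ⟨a, b, c, hab, hac, hbc, -⟩ := ht
  simp only [andrasfai] at hab hac hbc
  omega

/-- `andrasfai 0 = K₂`. [this work] -/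
theorem andrasfai_zero_eq_top : andrasfai 0 = ⊤ := by
  ext u v
  revert u v
  decide

/-- `andrasfai 1 = C₅` (Mathlib's `cycleGraph 5`). [this work] -/
theorem andrasfai_one_eq_cycleGraph : andrasfai 1 = SimpleGraph.cycleGraph 5 := by
  ext u v
  revert u v
  decide

/-- **CONJECTURE (And) (typed): every Andrásfai graph has an A-safe graph core.**  A sub-conjecture of `TriangleFreeSafe`
(`andrasfaiSafe_of_triangleFreeSafe`); instances `k = 0, 1` are theorems below; `k = 2` (`M₈`) is certified by the exact polarised census
(memo §5).  An obligation of this programme, never used as a fact. [conjecture, this work] -/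
@[conjecture] def AndrasfaiSafe : Prop :=
  ∀ (k : ℕ) (p : Fin (3 * k + 2) → unitInterval), Safe p (edgeCore (andrasfai k))

/-- (And) is a sub-conjecture of G△. [this work] -/
theorem andrasfaiSafe_of_triangleFreeSafe (h : TriangleFreeSafe) : AndrasfaiSafe :=
  fun k p => h _ (andrasfai k) (cliqueFree_three_andrasfai k) p

/-- Under (And), every blow-up of an Andrásfai graph (by Pach's theorem: every triangle-free graph in which each independent set has
a common neighbour) has an A-safe graph core. [this work] -/
theorem safe_andrasfai_comap_of_andrasfaiSafe (h : AndrasfaiSafe) (k : ℕ) (f : ι → Fin (3 * k + 2))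
    (p : ι → unitInterval) : Safe p (edgeCore ((andrasfai k).comap f)) :=
  aSafe_edgeCore_comap f (andrasfai k) (h k) p

/-- (And) for `k = 0`: the graph core of `K₂` is the principal filter `{0, 1 ∈ ω}`, safe by `safe_principal`. [this work] -/
theorem safe_andrasfai_zero (p : Fin (3 * 0 + 2) → unitInterval) : Safe p (edgeCore (andrasfai 0)) := by
  have h : edgeCore (andrasfai 0) = {ω | (↑(Finset.univ : Finset (Fin (3 * 0 + 2))) : Set (Fin (3 * 0 + 2))) ⊆ ω} := by
    rw [andrasfai_zero_eq_top]
    ext ω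
    simp only [edgeCore, SimpleGraph.top_adj, Set.mem_setOf_eq, Finset.coe_univ, Set.univ_subset_iff,
      Set.eq_univ_iff_forall]
    constructor
    · rintro ⟨u, v, huv, hu, hv⟩ w
      have key : ∀ u v w : Fin (3 * 0 + 2), u ≠ v → w = u ∨ w = v := by decide
      rcases key u v w huv with rfl | rfl
      · exact hu
      · exact hv
    · intro hω
      exact ⟨0, 1, by decide, hω 0, hω 1⟩
  rw [h]
  exact safe_principal p _

/-- (And) for `k = 1`: `andrasfai 1 = C₅`, the pentagon (`safe_edgeCore_pentagon_comap` with the identity blow-up). [this work] -/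
theorem safe_andrasfai_one (p : Fin (3 * 1 + 2) → unitInterval) : Safe p (edgeCore (andrasfai 1)) := by
  rw [andrasfai_one_eq_cycleGraph]
  have h := safe_edgeCore_pentagon_comap (id : Fin 5 → Fin 5) p
  rwa [SimpleGraph.comap_id] at h

end SafeCalc

end Summit.CriticalPhenomena.PercolationContinuityZ3.Theorems.SunflowerPartition
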